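import Literature.Analysis.FluidPDE.AxisymWeights
import Literature.Analysis.FluidPDE.AxisymmetricEuler
import Literature.Analysis.FluidPDE.AxisymOuterBounds
import Mathlib.MeasureTheory.Integral.MeanInequalities
import HarnessLib

/-!
# Seregin 2020, proof of Thm. 2.1: measure-theoretic tools of the Moser step for the swirl

Analysis/FluidPDE proofs file (theorems only; no definitions, no named facts), on the discharge
path of the named fact `Literature.Analysis.FluidPDE.Seregin2020_axisymmetricSingularPoint_typeII`
(G. Seregin, *Local regularity of axisymmetric solutions to the Navier–Stokes equations*, Anal.
Math. Phys. 10 (2020), Paper No. 46 = arXiv:2006.04140, Thm. 2.1). Elementary inputs of the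
estimates (2.3)–(2.5) of the printed proof (arXiv pp. 5–6):

* `lintegral_mul_mul_le_tenThirds_fiveHalves_tenThirds` — the three-factor Hölder inequality
  with exponents `10/3, 5/2, 10/3` ("For the second term, we are going to exploit the Hölder
  inequality. Indeed, `J₁ ≤ (1/(r₁-r)) (∫|v|^{10/3})^{3/10} (∫|ω|^{5/2})^{2/5} (∫|ψ²ω_N|^{10/3})^{3/10}`");
* `le_sqrt_add_of_sq_le_mul_add` — the absorption "After application of the Young inequality":
  `Y² ≤ c(a + bY)`, `Y < ∞` ⟹ `Y ≤ √(2ca) + cb` (in `[0, ∞]`);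
* (`|σ| ≤ ϱ|v|` is the tree's `abs_swirl_le_cylRadius_mul_norm'`, `AxisymOuterBounds`);
* `volume_cylRadius_le_inter_closedBall_le` — the tube `{ϱ ≤ ε} ∩ B̄(0,1)` has volume `≤ 8ε²`
  (the tree's `volume_thinCylinder_le`).

## References

* G. Seregin, Anal. Math. Phys. 10 (2020), Paper 46 = arXiv:2006.04140, proof of Thm. 2.1,
  pp. 5–6. [`Seregin2020`]
-/

noncomputable section

open MeasureTheory Set Function Filter Topology
open scoped NNReal ENNReal

namespace Literature.Analysis.FluidPDE

namespace Seregin2020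

/-! ### Three-factor Hölder -/

/-- **Hölder's inequality with exponents `10/3, 5/2, 10/3`** (`3/10 + 2/5 + 3/10 = 1`):
`∫ f g h ≤ (∫ f^{10/3})^{3/10} (∫ g^{5/2})^{2/5} (∫ h^{10/3})^{3/10}` for a.e.-measurable
`[0,∞]`-valued functions (Mathlib's two-factor `ENNReal.lintegral_mul_le_Lp_mul_Lq` twice:
`(10/3, 10/7)` and then `(7/4, 7/3)` on `g^{10/7} h^{10/7}`).
[cite: Seregin2020, proof of Thm. 2.1, Step I, the Hölder inequality for J₁ (arXiv p. 6)] -/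
theorem lintegral_mul_mul_le_tenThirds_fiveHalves_tenThirds {α : Type*} [MeasurableSpace α]
    (μ : Measure α) {f g h : α → ℝ≥0∞} (hf : AEMeasurable f μ) (hg : AEMeasurable g μ)
    (hh : AEMeasurable h μ) :
    ∫⁻ a, f a * g a * h a ∂μ ≤
      (∫⁻ a, f a ^ (10 / 3 : ℝ) ∂μ) ^ (3 / 10 : ℝ) * (∫⁻ a, g a ^ (5 / 2 : ℝ) ∂μ) ^ (2 / 5 : ℝ) *
        (∫⁻ a, h a ^ (10 / 3 : ℝ) ∂μ) ^ (3 / 10 : ℝ) := by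
  -- first Hölder: `f` against `g h`
  have hpq : (10 / 3 : ℝ).HolderConjugate (10 / 7) := Real.holderConjugate_iff.2 ⟨by norm_num, by norm_num⟩
  have h1 := ENNReal.lintegral_mul_le_Lp_mul_Lq μ hpq hf (hg.mul hh)
  have e1 : ∀ a, f a * g a * h a = (f * (g * h)) a := fun a => by simp only [Pi.mul_apply]; ring
  simp_rw [e1]
  refine h1.trans ?_
  -- second Hölder on `(g h)^{10/7} = g^{10/7} h^{10/7}`
  have hpq' : (7 / 4 : ℝ).HolderConjugate (7 / 3) := Real.holderConjugate_iff.2 ⟨by norm_num, by norm_num⟩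
  have h2 := ENNReal.lintegral_mul_le_Lp_mul_Lq μ hpq' (hg.pow_const (10 / 7 : ℝ)) (hh.pow_const (10 / 7 : ℝ))
  have e2 : ∀ a, (g * h) a ^ (10 / 7 : ℝ) = (((fun a => g a ^ (10 / 7 : ℝ)) * fun a => h a ^ (10 / 7 : ℝ)) a) := by
    intro a
    simp only [Pi.mul_apply]
    exact ENNReal.mul_rpow_of_nonneg _ _ (by norm_num)
  have e3 : ∀ a, (g a ^ (10 / 7 : ℝ)) ^ (7 / 4 : ℝ) = g a ^ (5 / 2 : ℝ) := fun a => by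
    rw [← ENNReal.rpow_mul]; norm_num
  have e4 : ∀ a, (h a ^ (10 / 7 : ℝ)) ^ (7 / 3 : ℝ) = h a ^ (10 / 3 : ℝ) := fun a => by
    rw [← ENNReal.rpow_mul]; norm_num
  simp_rw [e3, e4] at h2
  have h3 : (∫⁻ a, (g * h) a ^ (10 / 7 : ℝ) ∂μ) ^ (1 / (10 / 7) : ℝ) ≤
      ((∫⁻ a, g a ^ (5 / 2 : ℝ) ∂μ) ^ (1 / (7 / 4) : ℝ) * (∫⁻ a, h a ^ (10 / 3 : ℝ) ∂μ) ^ (1 / (7 / 3) : ℝ)) ^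
        (1 / (10 / 7) : ℝ) := by
    simp_rw [e2]
    exact ENNReal.rpow_le_rpow h2 (by norm_num)
  have e5 : ((∫⁻ a, g a ^ (5 / 2 : ℝ) ∂μ) ^ (1 / (7 / 4) : ℝ) * (∫⁻ a, h a ^ (10 / 3 : ℝ) ∂μ) ^ (1 / (7 / 3) : ℝ)) ^
      (1 / (10 / 7) : ℝ) =
      (∫⁻ a, g a ^ (5 / 2 : ℝ) ∂μ) ^ (2 / 5 : ℝ) * (∫⁻ a, h a ^ (10 / 3 : ℝ) ∂μ) ^ (3 / 10 : ℝ) := by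
    rw [ENNReal.mul_rpow_of_nonneg _ _ (by norm_num), ← ENNReal.rpow_mul, ← ENNReal.rpow_mul]
    norm_num
  rw [e5] at h3
  have e6 : (1 / (10 / 3) : ℝ) = 3 / 10 := by norm_num
  rw [e6]
  calc (∫⁻ a, f a ^ (10 / 3 : ℝ) ∂μ) ^ (3 / 10 : ℝ) * (∫⁻ a, (g * h) a ^ (10 / 7 : ℝ) ∂μ) ^ (1 / (10 / 7) : ℝ)
      ≤ (∫⁻ a, f a ^ (10 / 3 : ℝ) ∂μ) ^ (3 / 10 : ℝ) *
          ((∫⁻ a, g a ^ (5 / 2 : ℝ) ∂μ) ^ (2 / 5 : ℝ) * (∫⁻ a, h a ^ (10 / 3 : ℝ) ∂μ) ^ (3 / 10 : ℝ)) :=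
        mul_le_mul_right h3 _
    _ = _ := by ring

/-! ### The absorption step -/

/-- **Young's absorption** ("After application of the Young inequality, we arrive at the
estimate …", arXiv p. 6): in `[0, ∞]`, if `Y < ∞` and `Y² ≤ c (a + b Y)` then
`Y ≤ √(2ca) + c b` (`cbY ≤ Y²/2 + c²b²/2`). [cite: Seregin2020, proof of Thm. 2.1, Step II, "After application of the Young inequality" (arXiv p. 6)] -/
theorem le_sqrt_add_of_sq_le_mul_add {Y a b c : ℝ≥0∞} (hY : Y ≠ ∞) (h : Y ^ 2 ≤ c * (a + b * Y)) :
    Y ≤ (2 * c * a) ^ (1 / 2 : ℝ) + c * b := by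
  -- infinite data: the right-hand side is `∞` (unless the corresponding product vanishes)
  rcases eq_or_ne Y 0 with hY0 | hY0
  · rw [hY0]; exact zero_le
  by_cases hca : c * a = ∞
  · have : (2 * c * a) ^ (1 / 2 : ℝ) = ∞ := by
      rw [mul_assoc, hca, ENNReal.mul_top two_ne_zero, ENNReal.top_rpow_of_pos (by norm_num)]
    rw [this, top_add]
    exact le_top
  by_cases hcb : c * b = ∞
  · rw [hcb, add_top]; exact le_top
  -- finite data: real arithmetic
  have hY' : Y ^ 2 ≠ ∞ := ENNReal.pow_ne_top hY
  set y : ℝ := Y.toReal with hy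
  set p : ℝ := (c * a).toReal with hp
  set q : ℝ := (c * b).toReal with hq
  have hy0 : 0 ≤ y := ENNReal.toReal_nonneg
  have hp0 : 0 ≤ p := ENNReal.toReal_nonneg
  have hq0 : 0 ≤ q := ENNReal.toReal_nonneg
  have hreal : y ^ 2 ≤ p + q * y := by
    have h' : Y ^ 2 ≤ c * a + c * b * Y := by
      calc Y ^ 2 ≤ c * (a + b * Y) := h
        _ = c * a + c * b * Y := by ring
    have hfin : c * a + c * b * Y ≠ ∞ := ENNReal.add_ne_top.2 ⟨hca, ENNReal.mul_ne_top hcb hY⟩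
    have := (ENNReal.toReal_le_toReal hY' hfin).2 h'
    rw [ENNReal.toReal_pow, ENNReal.toReal_add hca (ENNReal.mul_ne_top hcb hY), ENNReal.toReal_mul] at this
    simpa [hy, hp, hq] using this
  -- `y ≤ √(2p) + q`
  have hs : 0 ≤ Real.sqrt (2 * p) := Real.sqrt_nonneg _
  have hkey : y ≤ Real.sqrt (2 * p) + q := by
    have h2 : y ^ 2 ≤ 2 * p + q ^ 2 := by nlinarith [sq_nonneg (y - q)]
    have hsq : Real.sqrt (2 * p) ^ 2 = 2 * p := Real.sq_sqrt (by positivity)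
    have h3 : y ^ 2 ≤ (Real.sqrt (2 * p) + q) ^ 2 := by nlinarith [mul_nonneg hq0 hs]
    exact (pow_le_pow_iff_left₀ hy0 (add_nonneg hs hq0) two_ne_zero).1 h3
  -- back to `[0, ∞]`
  have eY : Y = ENNReal.ofReal y := (ENNReal.ofReal_toReal hY).symm
  have ea : c * a = ENNReal.ofReal p := (ENNReal.ofReal_toReal hca).symm
  have eb : c * b = ENNReal.ofReal q := (ENNReal.ofReal_toReal hcb).symm
  have e1 : (2 * c * a) ^ (1 / 2 : ℝ) = ENNReal.ofReal (Real.sqrt (2 * p)) := by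
    rw [mul_assoc, ea, ← ENNReal.ofReal_ofNat 2, ← ENNReal.ofReal_mul (by norm_num),
      ENNReal.ofReal_rpow_of_nonneg (by positivity) (by norm_num), Real.sqrt_eq_rpow]
  rw [eY, e1, eb, ← ENNReal.ofReal_add hs hq0]
  exact ENNReal.ofReal_le_ofReal hkey

/-! ### Thin tubes about the axis are small -/

/-- **The tube `{ϱ ≤ ε} ∩ B̄(0, 1)` has volume at most `8ε²`** (it lies in the box
`[-ε, ε]² × [-1, 1]`; the tree's `volume_thinCylinder_le`). This is what makes the shell terms of
the removal of the axis cut-off small ("`(∫_{ε/2<ϱ<ε} dz)^{1/2} → 0` as `ε → 0`", arXiv p. 5).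
[cite: Seregin2020, proof of Thm. 2.1 (arXiv p. 5), the estimate of I₂] -/
theorem volume_cylRadius_le_inter_closedBall_le {ε : ℝ} (hε : 0 ≤ ε) :
    volume ({x : EuclideanSpace ℝ (Fin 3) | cylRadius x ≤ ε} ∩ Metric.closedBall (0 : EuclideanSpace ℝ (Fin 3)) 1) ≤
      ENNReal.ofReal (8 * ε ^ 2) := by
  have hsub : {x : EuclideanSpace ℝ (Fin 3) | cylRadius x ≤ ε} ∩ Metric.closedBall (0 : EuclideanSpace ℝ (Fin 3)) 1 ⊆
      {x : EuclideanSpace ℝ (Fin 3) | x 0 ^ 2 + x 1 ^ 2 ≤ ε ^ 2 ∧ ‖x‖ ^ 2 ≤ 1 ^ 2} := by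
    rintro x ⟨hx1, hx2⟩
    refine ⟨?_, ?_⟩
    · rw [← cylRadius_sq]
      exact pow_le_pow_left₀ (cylRadius_nonneg x) hx1 2
    · have : ‖x‖ ≤ 1 := by simpa using hx2
      exact pow_le_pow_left₀ (norm_nonneg x) this 2
  calc volume ({x : EuclideanSpace ℝ (Fin 3) | cylRadius x ≤ ε} ∩ Metric.closedBall (0 : EuclideanSpace ℝ (Fin 3)) 1)
      ≤ volume {x : EuclideanSpace ℝ (Fin 3) | x 0 ^ 2 + x 1 ^ 2 ≤ ε ^ 2 ∧ ‖x‖ ^ 2 ≤ 1 ^ 2} := measure_mono hsub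
    _ ≤ ENNReal.ofReal (8 * ε ^ 2 * 1) := volume_thinCylinder_le hε zero_le_one
    _ = ENNReal.ofReal (8 * ε ^ 2) := by rw [mul_one]

end Seregin2020

end Literature.Analysis.FluidPDE
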